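import Mathlib
import Summits.ResolutionOfSingularities.ResolutionOfSingularities.Theses.HilbertSamuelElimination
import Literature.AlgebraicGeometry.Resolution.ComponentGluing
import Literature.AlgebraicGeometry.Resolution.AlterationsDimension
import Literature.Order.WellQuasiOrder.EliminationTermination
import Literature.RingTheory.HilbertSamuel.TangentConeIdeal

/-!
# Sketch — first lemmas of the two crux ideas for `ModificationsResolve`
(crux stmt-ResolutionOfSingularities-18507, route HilbertSamuelElimination)

* idea `integral-tower`: `modificationsResolve_of_integral` (the transfer C⁺ → C, proved) and
  `isIntegral_and_dim_eq_of_isBirational` (one E-step keeps the tower integral and of the same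
  dimension, proved from tree lemmas).
* idea `wf-value-profile`: `isDershowitzMannaLT_of_maxElimStep` (one Σ^max-modification step is
  a Dershowitz–Manna decrease of the finite value profile, proved) and `wellFounded_maxElimLT`
  (the elimination order on finite value sets inside a p.w.o. set is well founded; signature).
-/

open CategoryTheory AlgebraicGeometry TopologicalSpace
open Literature.AlgebraicGeometry.Resolution

set_option linter.dupNamespace false

namespace Summit.ResolutionOfSingularities.ResolutionOfSingularities.Cruxes.ModificationsResolve.Sketch

open Summit.ResolutionOfSingularities.ResolutionOfSingularities.Theses.HilbertSamuelElimination

/-! ## idea `integral-tower` -/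

/-- TRANSFER (C⁺ → C, free): it suffices to prove the crux with an INTEGRAL conclusion —
`resolutionInChar_iff_integral` (tree, sorry-free, narrow cone `ComponentGluing`). -/
theorem modificationsResolve_of_integral
    (h : SigmaMaxModifications → ∀ p : ℕ, p.Prime → ∀ (k : Type) [Field k] [CharP k p]
      (X : Scheme.{0}) (f : X ⟶ Spec (.of k)), IsSeparated f → LocallyOfFiniteType f →
        QuasiCompact f → IsIntegral X → Scheme.HasResolution X) :
    ModificationsResolve := fun hE p hp =>
  (ComponentGluing.resolutionInChar_iff_integral p).mpr (fun k _ _ X f hs hl hq hi => h hE p hp k X f hs hl hq hi)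

/-- FIRST LEMMA of `integral-tower`: one step of the tower stays integral and keeps the
dimension — so `dim X_n = dim X_0 < N` along the whole tower and the tree's closedness /
finiteness lemmas (`Scheme.isClosed_hsMaxLocus_of_isExcellent_of_dim`,
`Scheme.finite_hsValues_of_isExcellent_of_dim`, both `topologicalKrullDim < N`) re-apply at every
stage with the SAME `N`. Ingredients: `ComponentGluing.IsBirational.irreducibleSpace`,
`topologicalKrullDim_opens_eq`, `topologicalKrullDim_eq_of_isOpenImmersion`. -/
theorem isIntegral_and_dim_eq_of_isBirational {k : Type} [Field k] {X' X : Scheme.{0}}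
    [IsIntegral X] [IsReduced X'] (f : X ⟶ Spec (.of k)) [LocallyOfFiniteType f]
    (π : X' ⟶ X) [LocallyOfFiniteType π] (hπ : IsBirational π) :
    IsIntegral X' ∧ topologicalKrullDim X' = topologicalKrullDim X := by
  haveI : IrreducibleSpace X' := ComponentGluing.IsBirational.irreducibleSpace hπ
  haveI : IsIntegral X' := isIntegral_of_irreducibleSpace_of_isReduced X'
  refine ⟨inferInstance, ?_⟩
  obtain ⟨U, hUd, hUd', hUiso⟩ := hπ
  haveI := hUiso
  have hne : ((π ⁻¹ᵁ U : X'.Opens) : Set X').Nonempty := hUd'.nonempty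
  haveI : Nonempty (π ⁻¹ᵁ U : X'.Opens) := hne.to_subtype
  calc topologicalKrullDim X' = topologicalKrullDim (π ⁻¹ᵁ U : X'.Opens) :=
        (topologicalKrullDim_opens_eq (π ≫ f) (π ⁻¹ᵁ U) hne).symm
    _ = topologicalKrullDim X := topologicalKrullDim_eq_of_isOpenImmersion f ((π ∣_ U) ≫ U.ι)

/-! ## idea `wf-value-profile` -/

/-- One `Σ^max`-modification step, seen on finite value profiles: `A` = `Σ_{X'}`, `B` = `Σ_X`;
(hmono) every new value is dominated by an old one; (ME2) no maximal old value survives. -/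
def MaxElimStep {V : Type*} [PartialOrder V] (A B : Finset V) : Prop :=
  B.Nonempty ∧ (∀ a ∈ A, ∃ b ∈ B, a ≤ b) ∧ ∀ m, Maximal (· ∈ B) m → m ∉ A

/-- FIRST LEMMA of `wf-value-profile` (proved): a `Σ^max`-modification step is a
Dershowitz–Manna decrease of the value profile — every new value lies STRICTLY below a maximal
old value. With `Multiset.wellFounded_isDershowitzMannaLT` (Mathlib) over the well-founded
(indeed p.w.o., `isPWO_hsValueSet`) value poset this makes `X ↦ Σ_X` a termination measure and
turns CJS Cor. 6.18 into ONE `WellFounded.induction`. -/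
theorem isDershowitzMannaLT_of_maxElimStep {V : Type*} [PartialOrder V] {A B : Finset V}
    (h : MaxElimStep A B) : Multiset.IsDershowitzMannaLT A.val B.val := by
  obtain ⟨hB, hdom, hME2⟩ := h
  refine ⟨0, A.val, B.val, ?_, by simp, by simp, ?_⟩
  · intro h0
    obtain ⟨b, hb⟩ := hB
    have : b ∈ (B.val : Multiset V) := hb
    rw [h0] at this
    exact Multiset.notMem_zero b this
  · intro a ha
    obtain ⟨b, hb, hab⟩ := hdom a ha
    obtain ⟨m, hbm, hm⟩ := B.exists_le_maximal hb
    refine ⟨m, hm.1, lt_of_le_of_ne (hab.trans hbm) ?_⟩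
    rintro rfl
    exact hME2 a hm ha

/-- The elimination order on finite value sets INSIDE a fixed set `S` of the value poset
(`S = hsValueSet ℚ e N`, `e` read off `Σ_{X_0}`): `A ≺ B` iff `B ⊆ S` and `A` arises from `B`
by a `Σ^max`-modification step. -/
def MaxElimLT {V : Type*} [PartialOrder V] (S : Set V) (A B : Finset V) : Prop :=
  ↑B ⊆ S ∧ MaxElimStep A B

/-- SIGNATURE (the reusable termination lemma of the line): the elimination order inside a
partially well-ordered set is well founded. Two proofs available: (a) from the tree's
`Literature.Order.WellQuasiOrder.no_infinite_maxElimination_sequence` via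
`RelEmbedding`/`wellFounded_iff_isEmpty_descending_chain` (a descending chain of finite sets IS a
tower of finite types with `H = Subtype.val`); (b) from `isDershowitzMannaLT_of_maxElimStep` and
`Multiset.wellFounded_isDershowitzMannaLT` on `Multiset ↥S` (`Set.IsPWO.isWF` ⇒ `WellFoundedLT ↥S`),
which needs only WELL-FOUNDEDNESS of `S`, not p.w.o. -/
theorem wellFounded_maxElimLT {V : Type*} [PartialOrder V] {S : Set V} (hS : S.IsPWO) :
    WellFounded (MaxElimLT S) := by
  classical
  refine wellFounded_iff_isEmpty_descending_chain.mpr ⟨fun ⟨A, hA⟩ => ?_⟩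
  -- a descending chain of finite value sets IS a tower of finite types with `H = Subtype.val`
  have hdom : ∀ n (a : ↥(A (n + 1))), ∃ b : ↥(A n), (a : V) ≤ b := fun n a => by
    obtain ⟨b, hb, hab⟩ := (hA n).2.2.1 a a.2
    exact ⟨⟨b, hb⟩, hab⟩
  choose π hπ using hdom
  have hr : ∀ m, Set.range (fun x : ↥(A m) => (x : V)) = (↑(A m) : Set V) := fun m => by
    ext v
    constructor
    · rintro ⟨x, rfl⟩; exact x.2
    · intro hv; exact ⟨⟨v, hv⟩, rfl⟩
  refine Literature.Order.WellQuasiOrder.no_infinite_maxElimination_sequence hS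
    (X := fun n => ↥(A n)) π (fun n (x : ↥(A n)) => (x : V)) ?_ ?_ ?_ ?_ ?_
  · intro n x; exact (hA n).1 x.2
  · intro n x; exact hπ n x
  · intro n; obtain ⟨b, hb⟩ := (hA n).2.1; exact ⟨⟨b, hb⟩⟩
  · intro n; exact Set.finite_range _
  · intro n ν hν hmem
    rw [hr n] at hν
    rw [hr (n + 1)] at hmem
    exact (hA n).2.2.2 ν hν hmem

/-- The RANKING PRINCIPLE (proved, scheme-free): any assignment `rank : Obj → Finset V` into the
elimination order inside a p.w.o. set supports strong induction — instantiate `Obj` with integral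
finite-type `k`-schemes (this crux), with excellent reduced Noetherian schemes of dimension `≤ 2`
(the tree's named fact `CossartJannsenSaito2020_corollary_6_18`), or with the states of a recursive
construction (CJS Rem. 6.29). -/
theorem rank_induction {V : Type*} [PartialOrder V] {S : Set V} (hS : S.IsPWO) {Obj : Sort*}
    (rank : Obj → Finset V) {P : Obj → Prop}
    (hstep : ∀ X, (∀ X', MaxElimLT S (rank X') (rank X) → P X') → P X) (X : Obj) : P X :=
  (InvImage.wf rank (wellFounded_maxElimLT hS)).induction X fun Y ih => hstep Y ih

/-- SHAPE of the crux proof under `wf-value-profile` (signature only): strong induction on the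
value profile, for integral `Y/k` of dimension `< N` whose Hilbert–Samuel values are dominated by
the finite set `S₀` (values of the original `X`), using the route's inline `H`. -/
theorem hasResolution_of_forall_maxElimLT (hE : SigmaMaxModifications) {p : ℕ} (hp : p.Prime)
    (k : Type) [Field k] [CharP k p] (N : ℕ) (S₀ : Finset (ℕ → ℕ)) :
    let H : (Y : Scheme.{0}) → Y → ℕ → ℕ := fun Y y =>
      Literature.RingTheory.HilbertSamuel.hilbertSamuelFun (Y.presheaf.stalk y)
        (N - Literature.RingTheory.HilbertSamuel.minimalPrimesCodim (Y.presheaf.stalk y))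
    ∀ (Y : Scheme.{0}) (g : Y ⟶ Spec (.of k)), IsSeparated g → LocallyOfFiniteType g →
      QuasiCompact g → IsIntegral Y → topologicalKrullDim Y < (N : WithBot ℕ∞) →
      (∀ y : Y, ∃ μ ∈ S₀, H Y y ≤ μ) → Scheme.HasResolution Y := by
  sorry

end Summit.ResolutionOfSingularities.ResolutionOfSingularities.Cruxes.ModificationsResolve.Sketch
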